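import Summits.Ventures.Crystal3D.Theorems.StickyWulffConstantCoaxialWallLawPayerTransCellGenericTop
import Summits.Ventures.Crystal3D.Theorems.StickyWulffConstantCoaxialWallLawPayerPairCount
import HarnessLib

/-!
# End accounting, census-free, multi-source IV‴: the TWO-PLATE generic translation cell

HONEST FRAMING. Part of the venture `Summits/Ventures/Crystal3D` (cell `crystal3d-full`), helper for the crux
`CoaxialWallLaw` (stmt-Ventures-19481) of `route-Ventures-StickyWulffConstant`, REGISTERED line `WallLedgerF`
(planner cf-p1), open stub `stub_coaxialTwoSlabAdhesion` (general fillings).  Rung credit only; F-C1 not moved.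
Memo HOME/wall-19481-p2/F-NEXT-SPEC.md §S1 (19481-p2 g4), planner (xxv) two-plate charging.  For a GENERIC-offset
translation pair (`3^k (s₂ − s₁) ∉ G₀ Λ₀` for all `k`) the pooled end pairs of the bottom plate
(`wordNet_trans_endPairs_generic_multi`) and of the top plate pulled back (`wordNet_trans_endPairs_generic_top`) are
DISJOINT for free — an end ball carries `3^k (b − s₁) ∈ G₀Λ₀` from below and `3^j (b − s₂) ∈ G₀Λ₀` from above, whence
`3^(k+j) (s₂ − s₁) ∈ G₀Λ₀` — and the union obeys the one capacity `card_endPairs_le_payers_closed`: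

`2 · (√2 · (Σ_{r rising} (G₀ r)₂) · π ρ²) − 24·(12√2π + 36R₀ + 55440) ρ ≤ 78 · #{z ∈ X : deg z ≤ 11, −R₀−2 ≤ z₂ ≤ h+R₀+2}`

(`wordNet_trans_payers_ge_generic_twoPlate`; `√2 Σ_{rising} (G₀ r)₂ = 2φ₁`, so the flux is `2φ₁ + 2φ₂` with `φ₂ = φ₁`).

WHAT THIS IS NOT: not the assembly into the stub's inequality (next file, charge `(φ₁+φ₂)/78`); F-C1 not moved.
-/

noncomputable section

namespace Summit.Ventures.Crystal3D.Theorems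

open Summit.Ventures.Crystal3D Finset
open Literature.MathematicalPhysics.StatisticalMechanics (fccStacking)
open scoped InnerProductSpace

open scoped Classical in
/-- **The two-plate generic translation cell.**  See the module docstring. -/
theorem wordNet_trans_payers_ge_generic_twoPlate
    {δ : ℝ} (hg : KissingGap δ) (hc : KissingClassification δ)
    (G₀ : EuclideanSpace ℝ (Fin 3) ≃ₗᵢ[ℝ] EuclideanSpace ℝ (Fin 3))
    (s₁ s₂ : EuclideanSpace ℝ (Fin 3)) (X P₁ P₂ : Finset (EuclideanSpace ℝ (Fin 3))) (R₀ h ρ : ℝ)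
    (hR₀ : 10 ≤ R₀) (hh : 0 ≤ h) (hρ : R₀ ≤ ρ)
    (hX : ∀ p ∈ X, ∀ q ∈ X, p ≠ q → 1 ≤ dist p q)
    (hcell : ∀ p ∈ X, -(2 * R₀) ≤ p 2 ∧ p 2 ≤ h + 2 * R₀ ∧ p 0 ^ 2 + p 1 ^ 2 ≤ ρ ^ 2)
    (hP₁X : P₁ ⊆ X) (hP₂X : P₂ ⊆ X)
    (hP₁ : ∀ p, p ∈ P₁ ↔ (p ∈ (fun q => G₀ q + s₁) '' fccStacking 1 (Real.sqrt (2 / 3)) ∧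
      -(2 * R₀) ≤ p 2 ∧ p 2 ≤ -R₀ ∧ p 0 ^ 2 + p 1 ^ 2 ≤ ρ ^ 2))
    (hP₂ : ∀ p, p ∈ P₂ ↔ (p ∈ (fun q => G₀ q + s₂) '' fccStacking 1 (Real.sqrt (2 / 3)) ∧
      h + R₀ ≤ p 2 ∧ p 2 ≤ h + 2 * R₀ ∧ p 0 ^ 2 + p 1 ^ 2 ≤ ρ ^ 2))
    (hgen : ∀ k : ℕ, ∀ q ∈ fccStacking 1 (Real.sqrt (2 / 3)), ((3 : ℝ) ^ k) • (s₂ - s₁) ≠ G₀ q) :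
    2 * (Real.sqrt 2 * (∑ r ∈ fccSlots.filter (fun r => 0 < (G₀ r) 2), (G₀ r) 2) * Real.pi * ρ ^ 2) -
        24 * (12 * Real.sqrt 2 * Real.pi + 36 * R₀ + 55440) * ρ ≤
      78 * ((X.filter fun z => (X.filter fun q => dist z q = 1).card ≤ 11 ∧
          -R₀ - 2 ≤ z 2 ∧ z 2 ≤ h + R₀ + 2).card : ℝ) := by
  obtain ⟨T₁, hflux₁, hTpair₁, hTpay₁, hTinv₁⟩ :=
    wordNet_trans_endPairs_generic_multi hg hc G₀ s₁ s₂ X P₁ P₂ R₀ h ρ hR₀ hh hρ hX hcell hP₁X hP₂X hP₁ hP₂ hgen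
  obtain ⟨T₂, hflux₂, hTpair₂, hTpay₂, hTinv₂⟩ :=
    wordNet_trans_endPairs_generic_top hg hc G₀ s₁ s₂ X P₁ P₂ R₀ h ρ hR₀ hh hρ hX hcell hP₁X hP₂X hP₁ hP₂ hgen
  have hpow : ∀ (k : ℕ) {x : EuclideanSpace ℝ (Fin 3)}, x ∈ fccStacking 1 (Real.sqrt (2 / 3)) →
      ((3 : ℝ) ^ k) • x ∈ fccStacking 1 (Real.sqrt (2 / 3)) := by
    intro k x hx
    have := fcc_zsmul_mem (3 ^ k) hx
    push_cast at this
    exact this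
  -- (1) the two pair sets are disjoint: the invariants of a common end ball contradict `hgen`
  have hdisj : Disjoint T₁ T₂ := by
    rw [Finset.disjoint_left]
    intro bq h₁ h₂
    obtain ⟨k, q₁, hq₁, hk⟩ := hTinv₁ bq h₁
    obtain ⟨j, q₂, hq₂, hj⟩ := hTinv₂ bq h₂
    refine hgen (k + j) (((3 : ℝ) ^ j) • q₁ - ((3 : ℝ) ^ k) • q₂)
      (by rw [sub_eq_add_neg]; exact fcc_add_site_mem (hpow j hq₁) (fcc_neg_mem (hpow k hq₂))) ?_
    rw [map_sub, LinearIsometryEquiv.map_smul, LinearIsometryEquiv.map_smul, ← hk, ← hj, smul_smul, smul_smul,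
      ← pow_add, ← pow_add, add_comm j k, ← smul_sub]
    congr 1
    abel
  -- (2) one capacity for the union
  have hU := card_endPairs_le_payers_closed hX (T₁.disjUnion T₂ hdisj) (R₀ := R₀) (h := h)
    (fun bq hbq => by
      rcases mem_disjUnion.1 hbq with h' | h'
      · obtain ⟨a, b, c, d, e⟩ := hTpair₁ bq h'
        exact ⟨a, b, c, d, e.le⟩
      · exact hTpair₂ bq h')
    (fun bq hbq => by
      rcases mem_disjUnion.1 hbq with h' | h'
      · exact hTpay₁ bq h'
      · exact hTpay₂ bq h')
  rw [card_disjUnion] at hU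
  have hPAYeq : (X.filter fun z => (X.filter fun q => dist z q = 1).card ≤ 11 ∧
      -R₀ - 1 - 1 ≤ z 2 ∧ z 2 ≤ h + R₀ + 1 + 1) =
      (X.filter fun z => (X.filter fun q => dist z q = 1).card ≤ 11 ∧ -R₀ - 2 ≤ z 2 ∧ z 2 ≤ h + R₀ + 2) := by
    refine filter_congr fun z _ => ?_
    rw [show -R₀ - 1 - 1 = -R₀ - 2 by ring, show h + R₀ + 1 + 1 = h + R₀ + 2 by ring]
  rw [hPAYeq] at hU
  have hcast : ((T₁.card : ℕ) : ℝ) + (T₂.card : ℝ) ≤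
      78 * ((X.filter fun z => (X.filter fun q => dist z q = 1).card ≤ 11 ∧
          -R₀ - 2 ≤ z 2 ∧ z 2 ≤ h + R₀ + 2).card : ℝ) := by
    exact_mod_cast hU
  linarith only [hflux₁, hflux₂, hcast]

end Summit.Ventures.Crystal3D.Theorems

end
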